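import Literature.AlgebraicGeometry.Resolution.OriginTaylor
import Literature.AlgebraicGeometry.Resolution.OriginQuadraticTransform
import Literature.RingTheory.TwoVariableSeries.Basic
import HarnessLib

/-!
# Transport of Taylor expansions along `F[x,y]_{(x,y)} ⊆ F[x',y']_{(x',y')}`

Topic: `Literature/AlgebraicGeometry/Resolution`. For two algebraically independent pairs `x, x'`
in an `F`-field `L` with `F[x]_{(x)} ⊆ F[x']_{(x')}` (`originLocalRing`, `OriginLocalRing.lean`),
the Taylor expansion `T'` of the bigger ring (`originTaylorAt`, `OriginTaylor.lean`) restricted to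
the smaller one is computed from polynomial representatives: if `z = f(x)/g(x)` with `g(0) ≠ 0`
and `gᵢ := T'(xᵢ) ∈ F[[X,Y]]` are the expansions of the old coordinates, then
`T'(z) · g(g₀,g₁) = f(g₀,g₁)` with `g(g₀,g₁)` a unit (`originTaylorAt_inclusion_mul`). This is the
formal content of "substituting `x = x₁y₁`, … , `x = x_pᵖ(y_p + α), y = x_p` into the expansions
(4)" in Cutkosky's proof of Lemma 3.1 (Math. Ann. 362 (2015), §3), done WITHOUT power-series
substitution. Consequences, all PROVED:

* residues (constant terms of Taylor expansions) do not depend on the ring in which they are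
  taken (`constantCoeff_originTaylorAt_inclusion`), and are computed from representatives;
* **Lemma K**: an `F`-algebra map killing the `gᵢ` sends `T'(z)` to the residue of `z`
  (`map_originTaylorAt_inclusion_eq_residue`) — e.g. "set `x_p = 0`" kills both
  `x = x_pᵖ(y_p+α)` and `y = x_p`;
* **Lemma K′**: first-order coefficients transport — if `coeff_{X_{k'}}(gᵢ) = coeff_{X_k}(Xᵢ)`
  then `coeff_{X_{k'}}(T' z) = coeff_{X_k}(T z)` (`coeff_single_one_originTaylorAt_inclusion`).

Everything here is [folklore].
-/

noncomputable section

namespace Literature.AlgebraicGeometry.Resolution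

open _root_.MvPolynomial IsLocalRing
open Literature.RingTheory.TwoVariableSeries

universe u v

variable {F : Type u} [Field F] {L : Type v} [Field L] [Algebra F L]

/-! ## Residues -/

section Residue

variable {n : ℕ} {x : Fin n → L} (hx : AlgebraicIndependent F x)

/-- The Taylor expansion of a scalar is the constant series. [folklore] -/
theorem originTaylorAt_algebraMap (c : F) :
    originTaylorAt hx (algebraMap F (originLocalRing hx) c) = MvPowerSeries.C c := by
  rw [AlgHom.commutes]
  rfl

/-- **The residue of `z ∈ F[x]_{(x)}` is the constant term of its Taylor expansion**: `z − c ∈ 𝔪`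
iff `c` is that constant term. [folklore] -/
theorem sub_algebraMap_mem_maximalIdeal_iff (z : originLocalRing hx) (c : F) :
    (haveI := isLocalRing_originLocalRing hx;
      z - algebraMap F (originLocalRing hx) c ∈ maximalIdeal (originLocalRing hx)) ↔
      MvPowerSeries.constantCoeff (originTaylorAt hx z) = c := by
  rw [← constantCoeff_originTaylorAt_eq_zero_iff, map_sub, originTaylorAt_algebraMap, map_sub,
    MvPowerSeries.constantCoeff_C, sub_eq_zero]

/-- The residue of a fraction `f(x)/g(x)`, `g(0) ≠ 0`, is `f(0)/g(0)`. [folklore] -/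
theorem constantCoeff_originTaylorAt_of_eq_div (z : originLocalRing hx) (f g : MvPolynomial (Fin n) F)
    (hg : constantCoeff g ≠ 0) (hz : (z : L) = aeval x f / aeval x g) :
    MvPowerSeries.constantCoeff (originTaylorAt hx z) = constantCoeff f / constantCoeff g := by
  rw [originTaylorAt_eq_of_eq_div hx z f g hg hz, map_mul, MvPowerSeries.constantCoeff_inv,
    constantCoeff_coe, constantCoeff_coe, div_eq_mul_inv]

/-- The residue map `z ↦ (T z)(0)` is multiplicative (it is a ring homomorphism). [folklore] -/
theorem constantCoeff_originTaylorAt_mul (z w : originLocalRing hx) :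
    MvPowerSeries.constantCoeff (originTaylorAt hx (z * w)) =
      MvPowerSeries.constantCoeff (originTaylorAt hx z) * MvPowerSeries.constantCoeff (originTaylorAt hx w) := by
  rw [map_mul, map_mul]

end Residue

/-! ## Transport along an inclusion of origin local rings -/

section Transport

variable {x : Fin 2 → L} (hx : AlgebraicIndependent F x) {x' : Fin 2 → L} (hx' : AlgebraicIndependent F x')

/-- The old coordinates as elements of the bigger ring. [folklore] -/
theorem coord_mem_of_le (hle : originLocalRing hx ≤ originLocalRing hx') (i : Fin 2) :
    x i ∈ originLocalRing hx' :=
  hle (mem_originLocalRing_self hx i)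

/-- **Polynomials transport**: `T'(f(x)) = f(T'(x₀), T'(x₁))`. [folklore] -/
theorem originTaylorAt_inclusion_aeval (hle : originLocalRing hx ≤ originLocalRing hx') (f : MvPolynomial (Fin 2) F) :
    originTaylorAt hx' ⟨aeval x f, hle (aeval_mem_originLocalRing hx f)⟩ =
      aeval (fun i => originTaylorAt hx' ⟨x i, coord_mem_of_le hx hx' hle i⟩) f := by
  set x'' : Fin 2 → originLocalRing hx' := fun i => ⟨x i, coord_mem_of_le hx hx' hle i⟩ with hx''
  have e : (⟨aeval x f, hle (aeval_mem_originLocalRing hx f)⟩ : originLocalRing hx') = aeval x'' f := by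
    apply Subtype.ext
    rw [coe_aeval_subalgebra]
  rw [e, ← AlgHom.comp_apply, MvPolynomial.comp_aeval]

/-- **Fractions transport (multiplicative form)**: for `z = f(x)/g(x) ∈ F[x]_{(x)}` with
`g(0) ≠ 0`, `T'(z) · g(T'x) = f(T'x)` in `F[[X,Y]]`. [folklore] -/
theorem originTaylorAt_inclusion_mul (hle : originLocalRing hx ≤ originLocalRing hx') {z : L}
    (hz : z ∈ originLocalRing hx) (f g : MvPolynomial (Fin 2) F)
    (hg : constantCoeff g ≠ 0) (hzfg : z = aeval x f / aeval x g) :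
    originTaylorAt hx' ⟨z, hle hz⟩ * aeval (fun i => originTaylorAt hx' ⟨x i, coord_mem_of_le hx hx' hle i⟩) g =
      aeval (fun i => originTaylorAt hx' ⟨x i, coord_mem_of_le hx hx' hle i⟩) f := by
  rw [← originTaylorAt_inclusion_aeval hx hx' hle g, ← originTaylorAt_inclusion_aeval hx hx' hle f, ← map_mul]
  congr 1
  apply Subtype.ext
  change z * aeval x g = aeval x f
  rw [hzfg, div_mul_cancel₀ _ (aeval_ne_zero_of_constantCoeff_ne_zero hx hg)]

/-- If the old coordinates lie in the maximal ideal of the bigger ring, their expansions vanish at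
the origin. [folklore] -/
theorem constantCoeff_originTaylorAt_coord_eq_zero (hle : originLocalRing hx ≤ originLocalRing hx')
    (hmax : ∀ i, haveI := isLocalRing_originLocalRing hx';
      (⟨x i, coord_mem_of_le hx hx' hle i⟩ : originLocalRing hx') ∈ maximalIdeal (originLocalRing hx')) (i : Fin 2) :
    MvPowerSeries.constantCoeff (originTaylorAt hx' ⟨x i, coord_mem_of_le hx hx' hle i⟩) = 0 :=
  (constantCoeff_originTaylorAt_eq_zero_iff hx' _).mpr (hmax i)

/-- The constant term of `h(g₀, g₁)` is `h(0)` when the `gᵢ` vanish at the origin. [folklore] -/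
theorem constantCoeff_aeval_eq_constantCoeff (g : Fin 2 → MvPowerSeries (Fin 2) F)
    (hg : ∀ i, MvPowerSeries.constantCoeff (g i) = 0) (h : MvPolynomial (Fin 2) F) :
    MvPowerSeries.constantCoeff (aeval g h) = constantCoeff h := by
  induction h using MvPolynomial.induction_on with
  | C a => rw [aeval_C, constantCoeff_C]; exact MvPowerSeries.constantCoeff_C a
  | add f g' hf hg' => rw [map_add, map_add, hf, hg', map_add]
  | mul_X f i hf => rw [map_mul, map_mul, hf, aeval_X, hg i, mul_zero, map_mul, MvPolynomial.constantCoeff_X, mul_zero]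

/-- With the old coordinates in the maximal ideal of the bigger ring, `g(T'x)` is a unit for
`g(0) ≠ 0`. [folklore] -/
theorem isUnit_aeval_originTaylorAt_coord (hle : originLocalRing hx ≤ originLocalRing hx')
    (hmax : ∀ i, haveI := isLocalRing_originLocalRing hx';
      (⟨x i, coord_mem_of_le hx hx' hle i⟩ : originLocalRing hx') ∈ maximalIdeal (originLocalRing hx'))
    {g : MvPolynomial (Fin 2) F} (hg : constantCoeff g ≠ 0) :
    IsUnit (aeval (fun i => originTaylorAt hx' ⟨x i, coord_mem_of_le hx hx' hle i⟩) g) := by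
  rw [MvPowerSeries.isUnit_iff_constantCoeff, constantCoeff_aeval_eq_constantCoeff _
    (constantCoeff_originTaylorAt_coord_eq_zero hx hx' hle hmax), isUnit_iff_ne_zero]
  exact hg

/-- **Residues do not depend on the ring**: for `z ∈ F[x]_{(x)} ⊆ F[x']_{(x')}` (old coordinates in
the new maximal ideal), the constant terms of the two Taylor expansions of `z` agree. [folklore] -/
theorem constantCoeff_originTaylorAt_inclusion (hle : originLocalRing hx ≤ originLocalRing hx')
    (hmax : ∀ i, haveI := isLocalRing_originLocalRing hx';
      (⟨x i, coord_mem_of_le hx hx' hle i⟩ : originLocalRing hx') ∈ maximalIdeal (originLocalRing hx'))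
    {z : L} (hz : z ∈ originLocalRing hx) :
    MvPowerSeries.constantCoeff (originTaylorAt hx' ⟨z, hle hz⟩) =
      MvPowerSeries.constantCoeff (originTaylorAt hx ⟨z, hz⟩) := by
  obtain ⟨f, g, hg, hzfg⟩ := (mem_originLocalRing_iff hx).mp hz
  have hmul := congrArg MvPowerSeries.constantCoeff (originTaylorAt_inclusion_mul hx hx' hle hz f g hg hzfg)
  have h0 := constantCoeff_originTaylorAt_coord_eq_zero hx hx' hle hmax
  rw [map_mul, constantCoeff_aeval_eq_constantCoeff _ h0, constantCoeff_aeval_eq_constantCoeff _ h0] at hmul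
  rw [constantCoeff_originTaylorAt_of_eq_div hx ⟨z, hz⟩ f g hg hzfg, eq_div_iff hg, hmul]

/-- **Lemma K** (an algebra map killing the old coordinates' expansions computes residues): if
`ψ : F[[X,Y]] →ₐ[F] S` satisfies `ψ(T' xᵢ) = 0` for both old coordinates then
`ψ(T' z) = residue(z)` for every `z ∈ F[x]_{(x)}`. (E.g. `ψ` = "set `x_p = 0`", which kills
`x = x_pᵖ(y_p+α)` and `y = x_p`.) [folklore] -/
theorem map_originTaylorAt_inclusion_eq_residue (hle : originLocalRing hx ≤ originLocalRing hx')
    {S : Type*} [CommRing S] [IsDomain S] [Algebra F S] (ψ : MvPowerSeries (Fin 2) F →ₐ[F] S)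
    (hψ : ∀ i, ψ (originTaylorAt hx' ⟨x i, coord_mem_of_le hx hx' hle i⟩) = 0)
    {z : L} (hz : z ∈ originLocalRing hx) :
    ψ (originTaylorAt hx' ⟨z, hle hz⟩) =
      algebraMap F S (MvPowerSeries.constantCoeff (originTaylorAt hx ⟨z, hz⟩)) := by
  obtain ⟨f, g, hg, hzfg⟩ := (mem_originLocalRing_iff hx).mp hz
  have hmul := congrArg ψ (originTaylorAt_inclusion_mul hx hx' hle hz f g hg hzfg)
  have hψa : ∀ h : MvPolynomial (Fin 2) F,
      ψ (aeval (fun i => originTaylorAt hx' ⟨x i, coord_mem_of_le hx hx' hle i⟩) h) =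
        algebraMap F S (constantCoeff h) := by
    intro h
    have h0 : (fun i => ψ (originTaylorAt hx' ⟨x i, coord_mem_of_le hx hx' hle i⟩)) = 0 := funext hψ
    rw [← AlgHom.comp_apply, MvPolynomial.comp_aeval, h0]
    exact MvPolynomial.aeval_zero h
  rw [map_mul, hψa, hψa] at hmul
  have hg0 : algebraMap F S (constantCoeff g) ≠ 0 := (map_ne_zero_iff _ (algebraMap F S).injective).mpr hg
  rw [constantCoeff_originTaylorAt_of_eq_div hx ⟨z, hz⟩ f g hg hzfg]
  apply mul_right_cancel₀ hg0
  rw [hmul, ← map_mul, div_mul_cancel₀ _ hg]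

/-- **Lemma K′** (transport of first-order coefficients): if the expansions `gᵢ = T'(xᵢ)` vanish at
the origin and `coeff_{X_{k'}}(gᵢ) = coeff_{X_k}(Xᵢ)` for `i = 0, 1`, then for every
`z ∈ F[x]_{(x)}` the `X_{k'}`-coefficient of `T'(z)` equals the `X_k`-coefficient of `T(z)`.
(Cutkosky §3: the `x_p`-coefficient after `x = x_pᵖ(y_p+α), y = x_p` is the old `y`-coefficient;
the `y_i`-coefficient after `x = x_i y_iⁱ, y = y_i` is the old `y`-coefficient.) [folklore] -/
theorem coeff_single_one_originTaylorAt_inclusion (hle : originLocalRing hx ≤ originLocalRing hx')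
    (k k' : Fin 2)
    (hmax : ∀ i, haveI := isLocalRing_originLocalRing hx';
      (⟨x i, coord_mem_of_le hx hx' hle i⟩ : originLocalRing hx') ∈ maximalIdeal (originLocalRing hx'))
    (hcoeff : ∀ i, MvPowerSeries.coeff (Finsupp.single k' 1) (originTaylorAt hx' ⟨x i, coord_mem_of_le hx hx' hle i⟩) =
      MvPowerSeries.coeff (Finsupp.single k 1) (MvPowerSeries.X i : MvPowerSeries (Fin 2) F))
    {z : L} (hz : z ∈ originLocalRing hx) :
    MvPowerSeries.coeff (Finsupp.single k' 1) (originTaylorAt hx' ⟨z, hle hz⟩) =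
      MvPowerSeries.coeff (Finsupp.single k 1) (originTaylorAt hx ⟨z, hz⟩) := by
  set gg : Fin 2 → MvPowerSeries (Fin 2) F := fun i => originTaylorAt hx' ⟨x i, coord_mem_of_le hx hx' hle i⟩
    with hgg
  have h0 := constantCoeff_originTaylorAt_coord_eq_zero hx hx' hle hmax
  -- first-order coefficients of transported polynomials
  have hpoly : ∀ h : MvPolynomial (Fin 2) F,
      MvPowerSeries.coeff (Finsupp.single k' 1) (aeval gg h) =
        MvPowerSeries.coeff (Finsupp.single k 1) (h : MvPowerSeries (Fin 2) F) := by
    intro h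
    induction h using MvPolynomial.induction_on with
    | C a =>
      rw [aeval_C, MvPolynomial.coe_C]
      change MvPowerSeries.coeff _ (MvPowerSeries.C a) = _
      rw [coeff_single_one_C, coeff_single_one_C]
    | add f g hf hg => rw [map_add, map_add, MvPolynomial.coe_add, map_add, hf, hg]
    | mul_X f i hf =>
      rw [map_mul, aeval_X, MvPolynomial.coe_mul, MvPolynomial.coe_X, coeff_single_one_mul,
        coeff_single_one_mul, hf, hcoeff i, h0 i, MvPowerSeries.constantCoeff_X, mul_zero,
        constantCoeff_aeval_eq_constantCoeff _ h0, constantCoeff_coe]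
  obtain ⟨f, g, hg, hzfg⟩ := (mem_originLocalRing_iff hx).mp hz
  -- Leibniz on `T' z · g(T'x) = f(T'x)` and on `T z · g = f`
  have hmul := originTaylorAt_inclusion_mul hx hx' hle hz f g hg hzfg
  have h1 := congrArg (MvPowerSeries.coeff (Finsupp.single k' 1)) hmul
  rw [coeff_single_one_mul, hpoly g, hpoly f, constantCoeff_aeval_eq_constantCoeff _ h0,
    constantCoeff_originTaylorAt_inclusion hx hx' hle hmax hz] at h1
  have hmul0 : originTaylorAt hx ⟨z, hz⟩ * (g : MvPowerSeries (Fin 2) F) = f := by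
    rw [originTaylorAt_eq_of_eq_div hx ⟨z, hz⟩ f g hg hzfg, mul_assoc,
      MvPowerSeries.inv_mul_cancel _ (by rwa [constantCoeff_coe]), mul_one]
  have h2 := congrArg (MvPowerSeries.coeff (Finsupp.single k 1)) hmul0
  rw [coeff_single_one_mul, constantCoeff_coe] at h2
  have hg0 : (constantCoeff g : F) ≠ 0 := hg
  have key : MvPowerSeries.coeff (Finsupp.single k' 1) (originTaylorAt hx' ⟨z, hle hz⟩) * constantCoeff g =
      MvPowerSeries.coeff (Finsupp.single k 1) (originTaylorAt hx ⟨z, hz⟩) * constantCoeff g := by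
    linear_combination h1 - h2
  exact mul_right_cancel₀ hg0 key

end Transport

/-! ## Inclusions given by polynomial substitutions -/

section PolyInclusion

variable {x : Fin 2 → L} (hx : AlgebraicIndependent F x) {x' : Fin 2 → L} (hx' : AlgebraicIndependent F x')

/-- **Inclusion criterion from polynomial expressions**: if each old coordinate is a polynomial
without constant term in the new coordinates, `xᵢ = sᵢ(x')`, `sᵢ(0) = 0`, then
`F[x]_{(x)} ⊆ F[x']_{(x')}`, the `xᵢ` lie in the new maximal ideal, and `T'(xᵢ) = sᵢ`.
[folklore] -/
theorem le_and_originTaylorAt_eq_of_eq_aeval (s : Fin 2 → MvPolynomial (Fin 2) F)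
    (hs0 : ∀ i, constantCoeff (s i) = 0) (hxs : ∀ i, x i = aeval x' (s i)) :
    ∃ hle : originLocalRing hx ≤ originLocalRing hx',
      (∀ i, haveI := isLocalRing_originLocalRing hx';
        (⟨x i, hle (mem_originLocalRing_self hx i)⟩ : originLocalRing hx') ∈ maximalIdeal (originLocalRing hx')) ∧
      ∀ i, originTaylorAt hx' ⟨x i, hle (mem_originLocalRing_self hx i)⟩ = (s i : MvPowerSeries (Fin 2) F) := by
  haveI := isLocalRing_originLocalRing hx'
  have hmem : ∀ i, x i ∈ originLocalRing hx' := fun i => by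
    rw [hxs i]; exact aeval_mem_originLocalRing hx' (s i)
  have hmax : ∀ i, (⟨x i, hmem i⟩ : originLocalRing hx') ∈ maximalIdeal (originLocalRing hx') := by
    intro i
    have e : (⟨x i, hmem i⟩ : originLocalRing hx') = aeval (originCoord hx') (s i) := by
      apply Subtype.ext
      rw [coe_aeval_subalgebra]
      exact hxs i
    rw [e]
    exact aeval_mem_maximalIdeal_of_constantCoeff_eq_zero _ (originCoord_mem_maximalIdeal hx') (hs0 i)
  refine ⟨originLocalRing_le_of_forall_mem_maximalIdeal hx hx' hmem hmax, hmax, fun i => ?_⟩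
  have e : (⟨x i, hmem i⟩ : originLocalRing hx') = ⟨aeval x' (s i), aeval_mem_originLocalRing hx' (s i)⟩ :=
    Subtype.ext (hxs i)
  rw [e, originTaylorAt_aeval]

end PolyInclusion

end Literature.AlgebraicGeometry.Resolution
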